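import Literature.Analysis.FluidPDE.Seregin2020SingularSetAxis
import Literature.Analysis.FluidPDE.CKNEpsilonRegularityAssemblyProofs
import HarnessLib

/-!
# Seregin 2020, proof of Theorem 2.1: the singular set of an axisymmetric suitable weak solution
# lies on the axis (interior points, centred cylinders)

Analysis/FluidPDE proof file (everything proved; no definitions, no named facts), companion of
`Seregin2020SingularSetAxis.lean` on the way to the named fact
`Literature.Analysis.FluidPDE.Seregin2020_axisymmetricSingularPoint_typeII` (G. Seregin, Anal.
Math. Phys. 10 (2020), Paper 46 = arXiv:2006.04140, Thm. 2.1; proof of (2.6), p. 5: "Denote by `S`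
the set of singular points of `v`. It is well known that `S` has 1D Hausdorff measure zero,
`x' = 0` for any `z = (x, t) ∈ S` …").

`Seregin2020.offAxis_regular` treats the points of `𝒞 × ]-1, 0]` with backward cylinders (the
form needed at the top time). Here the interior statement is recorded in the accepted vocabulary
of the partial regularity theory (`IsRegularPoint`, centred cylinders `Q*_r(z)`; `singularSet`,
CKN 1982, Theorem B): every interior point of `Q = 𝒞 × ]-1, 0[` off the axis is a regular point
(`Seregin2020.offAxis_isRegularPoint`), i.e. the singular set of `v` in `Q` lies on the axis
(`Seregin2020.singularSet_subset_axis`); together with `ckn_partial_regularity_holds` (`𝒫¹(S) = 0`)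
this is the quoted structure of `S`. Proof: the dissipation density `𝟙_Q |∇v|²` is rotation
invariant a.e. (`Seregin2020.dissipation_rot_invariant_ae`), so by the rotation packing
(`setLIntegral_prod_ball_le_of_rot_invariant`) `r⁻¹ ∫_{Q*_r(z)} |∇v|² ≤ |x'|⁻¹ ∫_{]t-r²,t+r²[ × 𝒞} |∇v|² → 0`,
and the ε-regularity criterion of Caffarelli–Kohn–Nirenberg in its centred multi-scale form
(`ckn_epsilon_regularity_holds`, CKN 1982, Prop. 2) applies at `z`.

## References

* G. Seregin, Anal. Math. Phys. 10 (2020), Paper 46 = arXiv:2006.04140, proof of Thm. 2.1 (p. 5).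
  [Seregin2020]
* L. Caffarelli, R. Kohn, L. Nirenberg, CPAM 35 (1982), Prop. 2 and Theorem B.
  [CaffarelliKohnNirenberg1982]
-/

noncomputable section

open MeasureTheory Set Function Filter Topology TopologicalSpace Metric Module
open scoped NNReal ENNReal

namespace Literature.Analysis.FluidPDE

namespace Seregin2020

open SereginSverak2009

/-- **Every interior point of `Q = 𝒞 × ]-1, 0[` off the axis is a regular point** of an
axisymmetric suitable weak solution of the class of Theorem 2.1 (centred cylinders,
`IsRegularPoint`). [cite: Seregin2020, proof of Thm. 2.1 (structure of the singular set, arXiv p. 5)] -/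
theorem offAxis_isRegularPoint
    {u : ℝ → EuclideanSpace ℝ (Fin 3) → EuclideanSpace ℝ (Fin 3)}
    {p : ℝ → EuclideanSpace ℝ (Fin 3) → ℝ}
    {G : ℝ → EuclideanSpace ℝ (Fin 3) → EuclideanSpace ℝ (Fin 3) →L[ℝ] EuclideanSpace ℝ (Fin 3)}
    (hsw : IsSuitableWeakSolutionOn (parCylOpens 0 1) 1 0 u p)
    (hG : HasWeakSpatialGradientOn (parCylOpens 0 1) u G)
    (hE : ∫⁻ z in parCyl 0 1, ENNReal.ofReal (frobeniusNormSq (G z.1 z.2)) < ∞)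
    (hu_ax : ∀ t ∈ Ioo (-1 : ℝ) 0, IsAxisymmetric (u t))
    {z : ℝ × EuclideanSpace ℝ (Fin 3)} (hz : z ∈ parCyl (0 : ℝ × EuclideanSpace ℝ (Fin 3)) 1)
    (hoff : 0 < cylRadius z.2) : IsRegularPoint u z := by
  obtain ⟨ε, hε, Hreg⟩ := ckn_epsilon_regularity_holds
  refine Hreg (parCylOpens 0 1) 0 u p hsw (isCKNForceOn_zero _) z hz fun G' hG' => ?_
  -- the dissipation density of `G'` is that of `G` (a.e. uniqueness), rotation invariant a.e.
  set F : ℝ × EuclideanSpace ℝ (Fin 3) → ℝ≥0∞ := (parCyl 0 1).indicator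
    (fun w : ℝ × EuclideanSpace ℝ (Fin 3) => ENNReal.ofReal (frobeniusNormSq (G' w.1 w.2))) with hF
  have hFrot : ∀ θ : ℝ, (fun w : ℝ × EuclideanSpace ℝ (Fin 3) => F (w.1, rotZ θ w.2)) =ᵐ[volume] F :=
    fun θ => dissipation_rot_invariant_ae hG' hu_ax θ
  have hmeas : MeasurableSet (parCyl (0 : ℝ × EuclideanSpace ℝ (Fin 3)) 1) :=
    (isOpen_parCyl 0 1).measurableSet
  have hE' : ∫⁻ w in parCyl 0 1, ENNReal.ofReal (frobeniusNormSq (G' w.1 w.2)) < ∞ := by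
    have hae := hG'.ae_eq hG
    rw [coe_parCylOpens] at hae
    calc ∫⁻ w in parCyl 0 1, ENNReal.ofReal (frobeniusNormSq (G' w.1 w.2))
        = ∫⁻ w in parCyl 0 1, ENNReal.ofReal (frobeniusNormSq (G w.1 w.2)) := by
          refine lintegral_congr_ae ?_
          filter_upwards [hae] with w hw
          change ENNReal.ofReal (frobeniusNormSq (uncurry G' w)) = ENNReal.ofReal (frobeniusNormSq (uncurry G w))
          rw [hw]
      _ < ∞ := hE
  have hFint : ∫⁻ w, F w ≠ ∞ := by
    rw [hF, lintegral_indicator hmeas]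
    exact hE'.ne
  -- the measures of the centred strips tend to zero
  set ρ₁ : ℝ := cylRadius z.2 with hρ₁
  have hvol : Tendsto (fun r : ℝ => volume (Ioo (z.1 - r ^ 2) (z.1 + r ^ 2) ×ˢ
      spaceCyl (0 : EuclideanSpace ℝ (Fin 3)) 1)) (𝓝[>] 0) (𝓝 0) := by
    have e : ∀ r : ℝ, 0 < r → volume (Ioo (z.1 - r ^ 2) (z.1 + r ^ 2) ×ˢ
        spaceCyl (0 : EuclideanSpace ℝ (Fin 3)) 1) =
        ENNReal.ofReal (2 * r ^ 2) * volume (spaceCyl (0 : EuclideanSpace ℝ (Fin 3)) 1) := by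
      intro r hr
      rw [Measure.volume_eq_prod, Measure.prod_prod, Real.volume_Ioo]
      congr 1
      congr 1
      ring
    have h1 : Tendsto (fun r : ℝ => ENNReal.ofReal (2 * r ^ 2)) (𝓝[>] (0 : ℝ)) (𝓝 0) := by
      have hc : Continuous fun r : ℝ => ENNReal.ofReal (2 * r ^ 2) :=
        ENNReal.continuous_ofReal.comp (by fun_prop)
      have := (hc.tendsto 0).mono_left (nhdsWithin_le_nhds (s := Ioi (0 : ℝ)))
      simpa using this
    have h2 := ENNReal.Tendsto.mul_const h1 (Or.inr volume_spaceCyl_zero_one_lt_top.ne)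
    rw [zero_mul] at h2
    refine h2.congr' ?_
    filter_upwards [self_mem_nhdsWithin] with r hr
    exact (e r hr).symm
  have hlim := tendsto_setLIntegral_zero (μ := volume) hFint hvol
  -- geometry: small centred cylinders about `z` lie in `Q`
  have hz' := hz
  rw [mem_parCyl_zero] at hz'
  obtain ⟨⟨ht1, ht0⟩, -, -⟩ := hz'
  simp only [one_pow] at ht1
  obtain ⟨r₀, hr₀, hball⟩ := Metric.isOpen_iff.1 (isOpen_spaceCyl 0 1) z.2 hz.2
  have hgeo : ∀ᶠ r in 𝓝[>] (0 : ℝ), parabolicCylinderCentered r z ⊆ parCyl 0 1 := by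
    have h1 : ∀ᶠ r in 𝓝[>] (0 : ℝ), r < r₀ := mem_nhdsWithin_of_mem_nhds (Iio_mem_nhds hr₀)
    have h2 : ∀ᶠ r in 𝓝[>] (0 : ℝ), r ^ 2 < -z.1 := by
      have hc : Continuous fun r : ℝ => r ^ 2 := by fun_prop
      have : ∀ᶠ r in 𝓝 (0 : ℝ), r ^ 2 < -z.1 := by
        have h0 : (fun r : ℝ => r ^ 2) 0 < -z.1 := by simp; linarith
        exact (hc.tendsto 0).eventually (Iio_mem_nhds h0)
      exact mem_nhdsWithin_of_mem_nhds this
    have h3 : ∀ᶠ r in 𝓝[>] (0 : ℝ), r ^ 2 < z.1 + 1 := by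
      have hc : Continuous fun r : ℝ => r ^ 2 := by fun_prop
      have : ∀ᶠ r in 𝓝 (0 : ℝ), r ^ 2 < z.1 + 1 := by
        have h0 : (fun r : ℝ => r ^ 2) 0 < z.1 + 1 := by simp; linarith
        exact (hc.tendsto 0).eventually (Iio_mem_nhds h0)
      exact mem_nhdsWithin_of_mem_nhds this
    filter_upwards [h1, h2, h3] with r hr1 hr2 hr3
    intro w hw
    rw [show parabolicCylinderCentered r z = Ioo (z.1 - r ^ 2) (z.1 + r ^ 2) ×ˢ ball z.2 r from rfl,
      mem_prod, mem_Ioo] at hw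
    obtain ⟨⟨hw1, hw2⟩, hw3⟩ := hw
    refine ⟨⟨?_, ?_⟩, hball (lt_trans (mem_ball.1 hw3) hr1)⟩
    · simp only [Prod.fst_zero, one_pow]; linarith
    · simp only [Prod.fst_zero]; linarith
  -- the scaled centred dissipation is eventually small
  have hev : ∀ᶠ r in 𝓝[>] (0 : ℝ), (ENNReal.ofReal r)⁻¹ *
      ∫⁻ q in parabolicCylinderCentered r z, ENNReal.ofReal (frobeniusNormSq (G' q.1 q.2)) ≤
        ENNReal.ofReal ε := by
    have hδ : (0 : ℝ≥0∞) < ENNReal.ofReal (ε * ρ₁) := ENNReal.ofReal_pos.2 (by positivity)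
    have hsmall := (tendsto_order.1 hlim).2 _ hδ
    have hρ : ∀ᶠ r in 𝓝[>] (0 : ℝ), r < ρ₁ := mem_nhdsWithin_of_mem_nhds (Iio_mem_nhds hoff)
    filter_upwards [hsmall, hρ, hgeo, self_mem_nhdsWithin] with r hr hrρ hrQ hrpos
    have hrpos' : (0 : ℝ) < r := hrpos
    -- `∫_{Q*_r(z)} |G'|² = ∫_{I × B} F`
    have e1 : ∫⁻ q in parabolicCylinderCentered r z, ENNReal.ofReal (frobeniusNormSq (G' q.1 q.2)) =
        ∫⁻ q in Ioo (z.1 - r ^ 2) (z.1 + r ^ 2) ×ˢ ball z.2 r, F q := by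
      rw [show parabolicCylinderCentered r z = Ioo (z.1 - r ^ 2) (z.1 + r ^ 2) ×ˢ ball z.2 r from rfl]
      refine setLIntegral_congr_fun (measurableSet_Ioo.prod measurableSet_ball) fun q hq => ?_
      rw [hF, indicator_of_mem (hrQ hq)]
    -- the full strip integral is the integral over `I × 𝒞`
    have e2 : ∫⁻ q in Ioo (z.1 - r ^ 2) (z.1 + r ^ 2) ×ˢ (univ : Set (EuclideanSpace ℝ (Fin 3))), F q =
        ∫⁻ q in Ioo (z.1 - r ^ 2) (z.1 + r ^ 2) ×ˢ spaceCyl (0 : EuclideanSpace ℝ (Fin 3)) 1, F q := by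
      have hset : parCyl (0 : ℝ × EuclideanSpace ℝ (Fin 3)) 1 ∩
          (Ioo (z.1 - r ^ 2) (z.1 + r ^ 2) ×ˢ (univ : Set (EuclideanSpace ℝ (Fin 3)))) =
          parCyl (0 : ℝ × EuclideanSpace ℝ (Fin 3)) 1 ∩
            (Ioo (z.1 - r ^ 2) (z.1 + r ^ 2) ×ˢ spaceCyl (0 : EuclideanSpace ℝ (Fin 3)) 1) := by
        ext q
        simp only [mem_inter_iff, mem_prod, mem_univ, and_true]
        constructor
        · rintro ⟨h1, h2⟩
          exact ⟨h1, h2, h1.2⟩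
        · rintro ⟨h1, h2, -⟩
          exact ⟨h1, h2⟩
      rw [hF, lintegral_indicator hmeas, lintegral_indicator hmeas, Measure.restrict_restrict hmeas,
        Measure.restrict_restrict hmeas, hset]
    -- packing
    have hpack := setLIntegral_prod_ball_le_of_rot_invariant hFrot hoff hrpos' hrρ.le
      (measurableSet_Ioo (a := z.1 - r ^ 2) (b := z.1 + r ^ 2))
    rw [e2] at hpack
    rw [e1]
    calc (ENNReal.ofReal r)⁻¹ * ∫⁻ q in Ioo (z.1 - r ^ 2) (z.1 + r ^ 2) ×ˢ ball z.2 r, F q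
        ≤ (ENNReal.ofReal r)⁻¹ * (ENNReal.ofReal (r / ρ₁) * ENNReal.ofReal (ε * ρ₁)) := by
          gcongr
          exact hpack.trans (by gcongr)
      _ = ENNReal.ofReal ε := by
          rw [div_eq_mul_inv r, ENNReal.ofReal_mul hrpos'.le, ← mul_assoc, ← mul_assoc,
            ENNReal.inv_mul_cancel (ENNReal.ofReal_pos.2 hrpos').ne' ENNReal.ofReal_ne_top, one_mul,
            ← ENNReal.ofReal_mul (inv_nonneg.2 hoff.le)]
          congr 1
          field_simp
  exact Filter.limsup_le_of_le (by isBoundedDefault) hev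

/-- **The singular set of an axisymmetric suitable weak solution lies on the axis** ("`x' = 0`
for any `z = (x, t) ∈ S`"): for the class of Theorem 2.1, `singularSet v Q ⊆ {x' = 0}`
(`Q = 𝒞 × ]-1, 0[`; with `ckn_partial_regularity_holds`, `𝒫¹(S) = 0`, this is the quoted structure
of `S`). [cite: Seregin2020, proof of Thm. 2.1 (structure of the singular set, arXiv p. 5)] -/
theorem singularSet_subset_axis
    {u : ℝ → EuclideanSpace ℝ (Fin 3) → EuclideanSpace ℝ (Fin 3)}
    {p : ℝ → EuclideanSpace ℝ (Fin 3) → ℝ}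
    {G : ℝ → EuclideanSpace ℝ (Fin 3) → EuclideanSpace ℝ (Fin 3) →L[ℝ] EuclideanSpace ℝ (Fin 3)}
    (hsw : IsSuitableWeakSolutionOn (parCylOpens 0 1) 1 0 u p)
    (hG : HasWeakSpatialGradientOn (parCylOpens 0 1) u G)
    (hE : ∫⁻ z in parCyl 0 1, ENNReal.ofReal (frobeniusNormSq (G z.1 z.2)) < ∞)
    (hu_ax : ∀ t ∈ Ioo (-1 : ℝ) 0, IsAxisymmetric (u t)) :
    singularSet u (parCyl (0 : ℝ × EuclideanSpace ℝ (Fin 3)) 1) ⊆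
      {z : ℝ × EuclideanSpace ℝ (Fin 3) | cylRadius z.2 = 0} := by
  intro z hz
  obtain ⟨hzQ, hsing⟩ := hz
  by_contra hne
  have hpos : 0 < cylRadius z.2 := lt_of_le_of_ne (cylRadius_nonneg _) (Ne.symm hne)
  exact hsing (offAxis_isRegularPoint hsw hG hE hu_ax hzQ hpos)

end Seregin2020

end Literature.Analysis.FluidPDE

end
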